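import Mathlib.LinearAlgebra.Matrix.Rank
import Mathlib.LinearAlgebra.FiniteDimensional.Lemmas
import Mathlib.FieldTheory.Finiteness
import Literature.NumberTheory.FaltingsSerre.S6Subgroups
import HarnessLib

/-!
# The Faltings–Serre method after Brumer–Pacetti–Poor–Tornaría–Voight–Yuen, XII:
# the RANK of `ι(σ) − 1` on `Z = 𝔽₂⁴` — `rank ≤ 1` exactly for the identity and the transpositions
# (the conductor-exponent dictionary of the residual step), kernel-checked and bridged to `Matrix.rank`

[BPPTVY] = A. Brumer, A. Pacetti, C. Poor, G. Tornaría, J. Voight, D. S. Yuen, *On the paramodularity of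
typical abelian surfaces*, Algebra & Number Theory **13**:5 (2019) 1145–1195 [cite: BrumerEtAl2019]
(PRINTED numbering and pages).  Verbatim, Lemma 4.3.10 p. 1172: "Let `K` be the fixed field of
`ker ρ̄_{f,ℓ}` and let `cond(ρ̄_{f,ℓ})` be the Artin conductor of the representation `ρ̄_{f,ℓ}` of
`Gal(K | ℚ)`.  If `p ∥ N` is odd, then `ord_p(cond(ρ̄_{f,ℓ})) ≤ 1`." (proof: "the representation is
necessarily either unramified or is Steinberg with level `p`, and accordingly the conductor has
`p`-valuation `0` or `1`"); proof of Proposition 5.2.4 p. 1175: "Decomposing the Weil–Deligne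
representation at `p`, we see by Lemma 4.3.10 that the image of inertia is either trivial or a
`2 × 2`-Jordan block. … Under the isomorphism `GSp₄(𝔽₂) ≃ S₆` above (5.1.1), nontrivial elements of this
Jordan block correspond to cycle decomposition `2 + 2 + 2` or `2 + 1 + 1 + 1 + 1`, and these are exchanged
by an outer automorphism"; Example 5.1.9 p. 1174: "`ι(S₅(b))` has transvections while `ι(S₅(a))` does
not"; Lemma 5.2.3 p. 1175 (tame discriminant exponent `= deg − #orbits of inertia`).

WHAT IS TYPED.  For a residual representation `ρ̄ = ι ∘ σ` (`σ : G_ℚ → S₆` the permutation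
representation, `ι` the printed map (5.1.1) = `GSp4F2.iota`) that is TAME at an odd prime `p` with
inertia generator `τ`, the exponent of `p` in the Artin conductor is the codimension of the inertia
invariants, `4 − dim_{𝔽₂} ker(ι(σ(τ)) − 1) = rank(ι(σ(τ)) − 1)` [folklore: Artin conductor, tame case].
So the printed bound `ord_p cond ≤ 1` says `rank(ι(σ(τ)) − 1) ≤ 1`, and the load-bearing finite fact of
the residual step — for the printed `ι`, NOT up to the outer automorphism — is

  **(D3)** `rank(ι(σ) − 1) ≤ 1 ⟺ σ = 1` or `σ` is a transposition; `rank(ι(σ) − 1) = 1 ⟺ σ` is a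
  transposition (so the "`2 × 2` Jordan block" of p. 1175 is, for OUR `ι`, the class `2+1+1+1+1`, never
  `2+2+2`: `ι((1 2)(3 4)(5 6)) − 1` has rank `2` although it too is a nontrivial unipotent involution).

Consequence used by the cell's certificates (pub-paramod, residual Step 1 "Route E", referee ruling
S42 `D3-kernel-owed`): `σ(τ)` has `≥ 5` orbits on the six letters, hence by Lemma 5.2.3 the sextic étale
algebra `E(ρ̄) = ⊕ Kᵢ` cut out by `σ` has `Σᵢ ord_p d_{Kᵢ} = 6 − #orbits(σ(τ)) ≤ 1`.
This file PROVES (standard axioms; the finite parts by `decide +kernel` over the `720` elements of `S₆`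
and the `16` vectors of `Z`):
* `GSp4F2.eight_le_fixedCount_iff`, `GSp4F2.fixedCount_eq_sixteen_iff` — KERNEL CHECKS: `ι(σ)` fixes
  `≥ 8` vectors of `Z = 𝔽₂⁴` iff `σ = 1` or `σ` is a transposition; all `16` iff `σ = 1`;
* `GSp4F2.minorsVanish_iotaE_add_one_iff` — KERNEL CHECK, the same in the language of `2 × 2` minors:
  all `2 × 2` minors of `ι(σ) − 1` vanish iff `σ = 1` or `σ` is a transposition;
* `GSp4F2.card_ker_iota_sub_one`, `GSp4F2.two_pow_finrank_ker_iota_sub_one`,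
  `GSp4F2.rank_iota_sub_one_add_finrank_ker` — the bridge to Mathlib: the fixed vectors are the kernel of
  `(ι(σ) − 1).mulVecLin`, `#ker = 2 ^ finrank ker` (`Module.card_eq_pow_finrank`), and rank–nullity
  `rank(ι(σ) − 1) + finrank ker = 4` (`Matrix.rank` := `finrank (range mulVecLin)`);
* **`GSp4F2.rank_iota_sub_one_le_one_iff`** — `(ι σ − 1).rank ≤ 1 ↔ σ = 1 ∨ σ.IsSwap` (THE (D3) lemma,
  with Mathlib's `Matrix.rank`); `GSp4F2.three_le_finrank_fixedSpace_iff` — the same as "the inertia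
  invariants have dimension `≥ 3`"; `GSp4F2.rank_iota_sub_one_eq_zero_iff` (`↔ σ = 1`),
  **`GSp4F2.rank_iota_sub_one_eq_one_iff`** (`↔ σ.IsSwap`);
* `GSp4F2.isTransvection_iota_iff_rank_eq_one` — reconciliation with `S6Subgroups.IsTransvection`
  (`≠ 1`, `(g+1)² = 0`, minors): on `ι(S₆)` it is exactly "`rank(g − 1) = 1`";
* `GSp4F2.rank_iota_sub_one_eq` — the general formula `rank(ι σ − 1) = 4 − log₂ (fixedCount σ)`, and
  `GSp4F2.tripleSwap_involution_rank_two` — the witness that "nontrivial involution with `(g − 1)² = 0`"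
  does NOT imply transvection: `σ = (1 2)(3 4)(5 6)` gives rank `2`.
Table (by `fixedCount`, second implementation = the cell's brute force in Python, lit-g6/referee-g46,
DIVERGENCE.md): `rank(ι(σ) − 1) = 0,1,2,2,2,3,3,3,4,4,4` on the cycle types
`1⁶, 2·1⁴, 3·1³, 2²·1², 2³, 4·1², 3·2·1, 4·2, 5·1, 3², 6` (only the first two rows are typed as theorems).

## References
* [BPPTVY] ANT 13:5 (2019): Lemma 4.3.10 p. 1172; §5.1 (5.1.1) p. 1173; Example 5.1.9 p. 1174;
  Lemma 5.2.3 and Proposition 5.2.4 with proof, p. 1175. [cite: BrumerEtAl2019]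
-/

namespace Literature.NumberTheory.FaltingsSerre.GSp4F2

open Matrix Equiv Equiv.Perm Finset Module

/-! ### A. Kernel checks over `S₆ × 𝔽₂⁴` -/

/-- The number of vectors of `Z = 𝔽₂⁴` fixed by `ι(σ)` (computed through the fast entry formula
`iotaE = ι`, `iota_eq_iotaE`), i.e. `#ker(ι(σ) − 1) = 2 ^ dim` of the invariants of the cyclic group
`⟨σ⟩` acting on `Z` through the printed `ι` (5.1.1). [cite: BrumerEtAl2019, (5.1.1) p. 1173] -/
def fixedCount (σ : Perm (Fin 6)) : ℕ := #{v : Fin 4 → ZMod 2 | iotaE σ *ᵥ v = v}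

set_option maxRecDepth 200000 in
/-- KERNEL CHECK over all `720` elements of `S₆` (`decide +kernel`): `ι(σ)` fixes at least `8` of the `16`
vectors of `Z` (the invariants have dimension `≥ 3`, i.e. `rank(ι(σ) − 1) ≤ 1`) iff `σ = 1` or `σ` is a
transposition — (D3) of the cell's Route E; for the printed `ι` the "`2 × 2` Jordan block" class is
`2+1+1+1+1`. [cite: BrumerEtAl2019, proof of Proposition 5.2.4 p. 1175] -/
theorem eight_le_fixedCount_iff :
    ∀ σ : Perm (Fin 6), 8 ≤ fixedCount σ ↔ σ = 1 ∨ ∃ a b : Fin 6, a ≠ b ∧ σ = swap a b := by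
  unfold fixedCount iotaE projZ loIdx hiIdx
  decide +kernel

set_option maxRecDepth 200000 in
/-- KERNEL CHECK over all of `S₆` (`decide +kernel`): `ι(σ)` fixes every vector of `Z` iff `σ = 1`
(faithfulness of `Z`, cf. `iota_injective`). [cite: BrumerEtAl2019, (5.1.1) p. 1173] -/
theorem fixedCount_eq_sixteen_iff : ∀ σ : Perm (Fin 6), fixedCount σ = 16 ↔ σ = 1 := by
  unfold fixedCount iotaE projZ loIdx hiIdx
  decide +kernel

/-- "All `2 × 2` minors of `g` vanish" — rank `≤ 1` in determinantal language (the third conjunct of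
`IsTransvection`). [folklore] -/
def MinorsVanish (g : Matrix (Fin 4) (Fin 4) (ZMod 2)) : Prop :=
  ∀ i j k l : Fin 4, i < j → k < l → g i k * g j l = g i l * g j k

/-- `MinorsVanish` is decidable (a finite conjunction over `𝔽₂`). [folklore] -/
instance (g : Matrix (Fin 4) (Fin 4) (ZMod 2)) : Decidable (MinorsVanish g) := by
  unfold MinorsVanish; infer_instance

set_option maxRecDepth 200000 in
/-- KERNEL CHECK over all `720` elements of `S₆` (`decide +kernel`), determinantal form of (D3): all
`2 × 2` minors of `ι(σ) − 1 = ι(σ) + 1` vanish iff `σ = 1` or `σ` is a transposition. [cite: BrumerEtAl2019, proof of Proposition 5.2.4 p. 1175] -/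
theorem minorsVanish_iotaE_add_one_iff :
    ∀ σ : Perm (Fin 6), MinorsVanish (iotaE σ + 1) ↔ σ = 1 ∨ ∃ a b : Fin 6, a ≠ b ∧ σ = swap a b := by
  unfold MinorsVanish iotaE projZ loIdx hiIdx
  decide +kernel

/-- The same for `ι` itself (`iota_eq_iotaE`; over `𝔽₂`, `ι(σ) − 1 = ι(σ) + 1`). [cite: BrumerEtAl2019, proof of Proposition 5.2.4 p. 1175] -/
theorem minorsVanish_iota_sub_one_iff (σ : Perm (Fin 6)) :
    MinorsVanish (iota σ - 1) ↔ σ = 1 ∨ σ.IsSwap := by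
  rw [Equiv.Perm.IsSwap, ← minorsVanish_iotaE_add_one_iff σ, iota_eq_iotaE, sub_eq_add_neg,
    ZModModule.neg_eq_self]

/-! ### B. The bridge to `Matrix.rank`: fixed vectors = `ker(ι(σ) − 1)`, `#ker = 2 ^ dim`, rank–nullity -/

/-- The vectors of `Z` fixed by `ι(σ)` are the kernel of `(ι(σ) − 1).mulVecLin`; their number is
`fixedCount σ`. [folklore] -/
theorem card_ker_iota_sub_one (σ : Perm (Fin 6)) :
    Nat.card (LinearMap.ker (iota σ - 1).mulVecLin) = fixedCount σ := by
  classical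
  rw [Nat.card_eq_fintype_card, fixedCount]
  refine Fintype.card_of_subtype _ fun v => ?_
  rw [Finset.mem_filter, LinearMap.mem_ker, Matrix.mulVecLin_apply, Matrix.sub_mulVec, Matrix.one_mulVec,
    sub_eq_zero, iota_eq_iotaE]
  simp

/-- `#ker(ι(σ) − 1) = 2 ^ dim ker` (`Module.card_eq_pow_finrank` over `𝔽₂`). [folklore] -/
theorem two_pow_finrank_ker_iota_sub_one (σ : Perm (Fin 6)) :
    2 ^ finrank (ZMod 2) (LinearMap.ker (iota σ - 1).mulVecLin) = fixedCount σ := by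
  classical
  rw [← card_ker_iota_sub_one, Nat.card_eq_fintype_card,
    Module.card_eq_pow_finrank (K := ZMod 2) (V := LinearMap.ker (iota σ - 1).mulVecLin), ZMod.card]

/-- Rank–nullity for `ι(σ) − 1` acting on `Z = 𝔽₂⁴`: `rank(ι(σ) − 1) + dim ker(ι(σ) − 1) = 4`
(`Matrix.rank A = finrank (range A.mulVecLin)`). [folklore] -/
theorem rank_iota_sub_one_add_finrank_ker (σ : Perm (Fin 6)) :
    (iota σ - 1).rank + finrank (ZMod 2) (LinearMap.ker (iota σ - 1).mulVecLin) = 4 := by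
  rw [Matrix.rank, LinearMap.finrank_range_add_finrank_ker, Module.finrank_fin_fun]

/-- The general formula `rank(ι(σ) − 1) = 4 − log₂ #(fixed vectors)`. [folklore] -/
theorem rank_iota_sub_one_eq (σ : Perm (Fin 6)) : (iota σ - 1).rank = 4 - Nat.log 2 (fixedCount σ) := by
  have h1 := rank_iota_sub_one_add_finrank_ker σ
  rw [← two_pow_finrank_ker_iota_sub_one, Nat.log_pow (by norm_num)]
  omega

/-! ### C. (D3) with Mathlib's `Matrix.rank` -/

/-- **(D3), conductor form.**  `rank(ι(σ) − 1) ≤ 1` — for a tame residual representation `ι ∘ σ` with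
inertia generator `τ` at `p`, the printed bound `ord_p cond(ρ̄) ≤ 1` of Lemma 4.3.10 applied to
`σ = σ(τ)` — holds iff `σ = 1` or `σ` is a transposition.  Hence `σ(τ)` has at least `5` orbits on the
six letters and, by Lemma 5.2.3, the fields `Kᵢ` of the sextic étale algebra of `σ` satisfy
`Σᵢ ord_p d_{Kᵢ} ≤ 1`. [cite: BrumerEtAl2019, Lemma 4.3.10 p. 1172 and proof of Proposition 5.2.4 p. 1175] -/
theorem rank_iota_sub_one_le_one_iff (σ : Perm (Fin 6)) :
    (iota σ - 1).rank ≤ 1 ↔ σ = 1 ∨ σ.IsSwap := by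
  have h1 := rank_iota_sub_one_add_finrank_ker σ
  have h2 := two_pow_finrank_ker_iota_sub_one σ
  have h3 := eight_le_fixedCount_iff σ
  set k := finrank (ZMod 2) (LinearMap.ker (iota σ - 1).mulVecLin) with hk
  rw [Equiv.Perm.IsSwap, ← h3, ← h2]
  constructor
  · intro h
    calc (8 : ℕ) = 2 ^ 3 := by norm_num
      _ ≤ 2 ^ k := Nat.pow_le_pow_right (by norm_num) (by omega)
  · intro h
    have hk3 : 3 ≤ k := by
      by_contra hlt
      have : 2 ^ k ≤ 2 ^ 2 := Nat.pow_le_pow_right (by norm_num) (by omega)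
      omega
    omega

/-- **(D3), invariants form**: the `ι(σ)`-invariants of `Z = 𝔽₂⁴` have dimension `≥ 3` (codimension
`≤ 1`, i.e. conductor exponent `≤ 1` in the tame case) iff `σ = 1` or `σ` is a transposition. [cite: BrumerEtAl2019, Lemma 4.3.10 p. 1172 and proof of Proposition 5.2.4 p. 1175] -/
theorem three_le_finrank_fixedSpace_iff (σ : Perm (Fin 6)) :
    3 ≤ finrank (ZMod 2) (LinearMap.ker (iota σ - 1).mulVecLin) ↔ σ = 1 ∨ σ.IsSwap := by
  rw [← rank_iota_sub_one_le_one_iff]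
  have h1 := rank_iota_sub_one_add_finrank_ker σ
  omega

/-- `rank(ι(σ) − 1) = 0 ⟺ σ = 1` (`Z` is a faithful `S₆`-module). [cite: BrumerEtAl2019, (5.1.1) p. 1173] -/
theorem rank_iota_sub_one_eq_zero_iff (σ : Perm (Fin 6)) : (iota σ - 1).rank = 0 ↔ σ = 1 := by
  have h1 := rank_iota_sub_one_add_finrank_ker σ
  have h2 := two_pow_finrank_ker_iota_sub_one σ
  have h3 := fixedCount_eq_sixteen_iff σ
  set k := finrank (ZMod 2) (LinearMap.ker (iota σ - 1).mulVecLin) with hk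
  rw [← h3, ← h2]
  constructor
  · intro h
    have : k = 4 := by omega
    rw [this]; norm_num
  · intro h
    have hk4 : k = 4 := Nat.pow_right_injective (le_refl 2) (show 2 ^ k = 2 ^ 4 by rw [h])
    omega

/-- **(D3), transvection form**: `rank(ι(σ) − 1) = 1` (i.e. `ι(σ)` is a transvection of `Z`) iff `σ`
is a transposition — under the PRINTED `ι` of (5.1.1) transvections correspond to the cycle type
`2+1+1+1+1`, not `2+2+2`. [cite: BrumerEtAl2019, Example 5.1.9 p. 1174 and proof of Proposition 5.2.4 p. 1175] -/
theorem rank_iota_sub_one_eq_one_iff (σ : Perm (Fin 6)) : (iota σ - 1).rank = 1 ↔ σ.IsSwap := by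
  have hle := rank_iota_sub_one_le_one_iff σ
  have h0 := rank_iota_sub_one_eq_zero_iff σ
  constructor
  · intro h
    rcases hle.1 h.le with h1 | hs
    · exact absurd (h0.2 h1) (by omega)
    · exact hs
  · intro hs
    have hle' := hle.2 (Or.inr hs)
    have hne : (iota σ - 1).rank ≠ 0 := by
      intro h
      obtain ⟨a, b, hab, rfl⟩ := hs
      exact hab (Equiv.swap_eq_one_iff.mp (h0.1 h))
    omega

/-- Reconciliation with `IsTransvection` (`S6Subgroups.lean`: `g ≠ 1 ∧ (g + 1)² = 0 ∧` all `2 × 2` minors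
of `g + 1` vanish): on the image of `ι` it is exactly the rank-one condition `rank(g − 1) = 1`. [cite: BrumerEtAl2019, Example 5.1.9 p. 1174] -/
theorem isTransvection_iota_iff_rank_eq_one (σ : Perm (Fin 6)) :
    IsTransvection (iota σ) ↔ (iota σ - 1).rank = 1 := by
  rw [isTransvection_iota_iff, rank_iota_sub_one_eq_one_iff]

/-! ### D. The class `2+2+2` is NOT a transvection for the printed `ι` -/

/-- `(1 2)(3 4)(5 6) ∈ S₆` (letters `1,…,6` ↦ `Fin 6` values `0,…,5`). [cite: BrumerEtAl2019, proof of Proposition 5.2.4 p. 1175] -/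
def tripleSwap : Perm (Fin 6) := swap 0 1 * swap 2 3 * swap 4 5

/-- KERNEL CHECK: `ι((1 2)(3 4)(5 6))` fixes exactly `4` vectors of `Z`. [cite: BrumerEtAl2019, proof of Proposition 5.2.4 p. 1175] -/
theorem fixedCount_tripleSwap : fixedCount tripleSwap = 4 := by
  unfold fixedCount tripleSwap iotaE projZ loIdx hiIdx
  decide

/-- The witness behind the remark "nontrivial elements of this Jordan block correspond to cycle
decomposition `2+2+2` or `2+1+1+1+1`, and these are exchanged by an outer automorphism": for the PRINTED
`ι`, `g = ι((1 2)(3 4)(5 6))` is a nontrivial involution with `(g − 1)² = 0` but `rank(g − 1) = 2`, so it is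
NOT a transvection — whereas `ι((1 2))` is (`rank_iota_sub_one_eq_one_iff`, `m12_transvection`).  Thus
"`g ≠ 1 ∧ (g − 1)² = 0`" alone does not characterize transvections in characteristic `2`; the rank
condition is the operative one. [cite: BrumerEtAl2019, proof of Proposition 5.2.4 p. 1175] -/
theorem tripleSwap_involution_rank_two :
    (iota tripleSwap - 1).rank = 2 ∧ (iota tripleSwap - 1) * (iota tripleSwap - 1) = 0 ∧
      iota tripleSwap ≠ 1 := by
  refine ⟨?_, ?_, ?_⟩
  · rw [rank_iota_sub_one_eq, fixedCount_tripleSwap]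
    decide
  · unfold iota tripleSwap projZ basisZ permAction
    decide
  · intro h
    have h1 : tripleSwap = 1 := eq_one_of_iota_eq_one h
    revert h1
    unfold tripleSwap
    decide

end Literature.NumberTheory.FaltingsSerre.GSp4F2
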